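import Summits.ResolutionOfSingularities.ResolutionOfSingularities.Theorems.RadicialJungCleanModelsF75cPrincipalizationPiece
import HarnessLib

/-!
# [F-75c discharge, brick N3] Principalization of an ideal sheaf by point blow-ups on a regular surface which is NOT
# assumed integral (The Stacks Project, Lemma 54.4.1 = Tag 0AHH / Lemma 54.15.5 = Tag 0BIB)

Cell res-hironaka, D-0154 INPUTS discharger `res-inputs-p-f75c` for the named fact F-75c
`Literature.AlgebraicGeometry.Resolution.Stacks0BIC_embeddedResolutionCurvesInSurfaces_locus`
(`--supports stmt-ResolutionOfSingularities-15917 --as helper`). A Noetherian scheme with regular local rings is the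
disjoint union of its finitely many irreducible components, each open, closed and integral (brick N1). Running brick N2
(principalization over one integral open-and-closed piece) over the components one after the other — the composition
built so far is an isomorphism over the untreated components (`IsPointBlowupComposition.isIso_morphismRestrict`), so
their preimages are again integral open-and-closed pieces — gives:

* **`exists_isPointBlowupComposition_isLocallyPrincipal'`** — for `X` Noetherian, regular, excellent, `dim ≤ 2`
  (no integrality) and an ideal sheaf `I`: a composition of blowing ups at closed points lying in the non-locally-
  principal locus of `I` makes `I·𝒪` locally principal.

HONEST FRAMING: bookkeeping over this seat's bricks N1/N2 and tree theorems; nothing here is a statement of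
[Hironaka2017]. AI-written; AI review is weaker than expert review. References: The Stacks Project, Tags 0AHH, 0BIB [StacksProject].
-/

noncomputable section

set_option linter.dupNamespace false -- mandated namespace of this single-conjunct summit

open CategoryTheory AlgebraicGeometry TopologicalSpace IsLocalRing

namespace Summit.ResolutionOfSingularities.ResolutionOfSingularities.Theorems

namespace F75c

open Literature.AlgebraicGeometry.Resolution
open Scheme.IdealSheafData

universe u

/-- **Principalization by point blow-ups on a regular surface, general (non-integral) case** (Stacks Tags 0AHH/0BIB):
component by component via brick N2. [cite: StacksProject, Tag 0AHH (Lemma 54.4.1)] [cite: StacksProject, Tag 0BIB (Lemma 54.15.5)] -/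
theorem exists_isPointBlowupComposition_isLocallyPrincipal' (X : Scheme.{u}) [IsNoetherian X]
    (hreg : Scheme.IsRegular X) (hexc : Scheme.IsExcellent X) (hdim : topologicalKrullDim X ≤ 2)
    (I : X.IdealSheafData) :
    ∃ (X' : Scheme.{u}) (π : X' ⟶ X), IsPointBlowupComposition (nonPrincipalLocus I : Set X) π ∧
      IsLocallyPrincipal (I.comap π) := by
  classical
  have hfin : (irreducibleComponents X).Finite := NoetherianSpace.finite_irreducibleComponents
  -- induction over the set of components already treated
  suffices H : ∀ (𝒦 : Set (Set X)), 𝒦 ⊆ irreducibleComponents X → 𝒦.Finite →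
      ∃ (X' : Scheme.{u}) (π : X' ⟶ X),
        IsPointBlowupComposition ((nonPrincipalLocus I : Set X) ∩ ⋃ C ∈ 𝒦, C) π ∧
        ∀ x' : X', π x' ∈ (⋃ C ∈ 𝒦, C) → IsLocallyPrincipalAt (I.comap π) x' by
    obtain ⟨X', π, hπ, hlp⟩ := H _ subset_rfl hfin
    refine ⟨X', π, hπ.mono Set.inter_subset_left, fun x' => hlp x' ?_⟩
    exact Set.mem_biUnion (irreducibleComponent_mem_irreducibleComponents (π x')) mem_irreducibleComponent
  intro 𝒦 h𝒦 h𝒦fin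
  induction 𝒦, h𝒦fin using Set.Finite.induction_on with
  | empty =>
    refine ⟨X, 𝟙 X, ?_, fun x' hx' => ?_⟩
    · simpa using (IsPointBlowupComposition.nil : IsPointBlowupComposition
        ((nonPrincipalLocus I : Set X) ∩ ⋃ C ∈ (∅ : Set (Set X)), C) (𝟙 X))
    · simp at hx'
  | @insert C 𝒦' hC𝒦' h𝒦'fin ih =>
    have hC : C ∈ irreducibleComponents X := h𝒦 (Set.mem_insert _ _)
    have h𝒦' : 𝒦' ⊆ irreducibleComponents X := (Set.subset_insert _ _).trans h𝒦
    obtain ⟨X', π, hπ, hlp⟩ := ih h𝒦'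
    obtain ⟨hN', hreg', hexc', hdim'⟩ := IsPointBlowupComposition.invariants hπ hreg hexc hdim
    haveI := hN'
    -- the component `C` as an open-and-closed integral piece `U`
    set U : X.Opens := X.irreducibleComponentOpen C with hU
    have hUC : (U : Set X) = C := hreg.coe_irreducibleComponentOpen hC
    have hUcl : IsClosed (U : Set X) := by rw [hUC]; exact isClosed_of_mem_irreducibleComponents C hC
    haveI hUint : IsIntegral (U : Scheme.{u}) := by
      haveI : IsReduced X := hreg.isReduced
      haveI : IsReduced (U : Scheme.{u}) := isReduced_of_isOpenImmersion U.ι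
      haveI : IrreducibleSpace (U : Scheme.{u}) :=
        Subtype.irreducibleSpace (show IsIrreducible ((U : X.Opens) : Set X) by rw [hUC]; exact hC.1)
      exact isIntegral_of_irreducibleSpace_of_isReduced _
    -- `π` is an isomorphism over `U` (the treated components are disjoint from `C`)
    have hdisj : Disjoint (U : Set X) ((nonPrincipalLocus I : Set X) ∩ ⋃ C' ∈ 𝒦', C') := by
      rw [hUC, Set.disjoint_left]
      rintro z hzC ⟨-, hz⟩
      rw [Set.mem_iUnion₂] at hz
      obtain ⟨C', hC', hzC'⟩ := hz
      exact hC𝒦' ((hreg.eq_of_mem_irreducibleComponents z hC (h𝒦' hC') hzC hzC') ▸ hC')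
    haveI hiso : IsIso (π ∣_ U) := hπ.isIso_morphismRestrict U hdisj
    -- the piece upstairs
    set U' : X'.Opens := π ⁻¹ᵁ U with hU'
    have hU'cl : IsClosed (U' : Set X') := hUcl.preimage π.continuous
    haveI : IsIntegral (U' : Scheme.{u}) := by
      obtain ⟨c, hc⟩ := hC.1.nonempty
      have hcU : c ∈ U := by rw [← hUC] at hc; exact hc
      obtain ⟨c', -⟩ := (ConcreteCategory.bijective_of_isIso ((π ∣_ U).base)).2 ⟨c, hcU⟩
      haveI : Nonempty (U' : Scheme.{u}) := ⟨c'⟩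
      exact isIntegral_of_isOpenImmersion (π ∣_ U)
    -- brick N2 on the piece
    obtain ⟨X'', π', hπ', hlp'⟩ := exists_isPointBlowupComposition_isLocallyPrincipalAt_over X' hreg' hexc' hdim' U'
      hU'cl inferInstance (I.comap π)
    refine ⟨X'', π' ≫ π, ?_, fun x'' hx'' => ?_⟩
    · refine (hπ.mono ?_).comp ?_ hπ'
      · exact Set.inter_subset_inter_right _ (Set.biUnion_subset_biUnion_left (Set.subset_insert _ _))
      · rintro _ ⟨x', ⟨hx'NP, hx'U⟩, rfl⟩
        refine ⟨nonPrincipalLocus_comap_subset π I hx'NP, Set.mem_biUnion (Set.mem_insert _ _) ?_⟩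
        rw [← hUC]; exact hx'U
    · rw [Scheme.IdealSheafData.comap_comp]
      rw [Scheme.Hom.comp_apply, Set.biUnion_insert] at hx''
      rcases hx'' with hx'' | hx''
      · exact hlp' x'' (by rw [← hUC] at hx''; exact hx'')
      · exact (hlp (π' x'') hx'').comap π'

end F75c

end Summit.ResolutionOfSingularities.ResolutionOfSingularities.Theorems

end
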